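import Summits.ResolutionOfSingularities.ResolutionOfSingularities.Theorems.FrobeniusLadderFInjectiveMacaulayficationProp44SliceCurvePlumbing
import Summits.ResolutionOfSingularities.ResolutionOfSingularities.Theorems.FrobeniusLadderFInjectiveMacaulayficationProp44Invariants
import Summits.ResolutionOfSingularities.ResolutionOfSingularities.Theorems.FrobeniusLadderFInjectiveMacaulayficationProp44SliceDimTwoCodim
import Literature.AlgebraicGeometry.Resolution.CurveGenericChainTermination
import Literature.AlgebraicGeometry.Resolution.CurveCentreNearPointDimension
import Literature.AlgebraicGeometry.Resolution.NearPointsCurveCentre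
import Literature.AlgebraicGeometry.Resolution.OrderSemicontinuity
import Literature.AlgebraicGeometry.Resolution.BlowupDimension
import HarnessLib

/-!
# [CoP1] Prop. 4.4 (`CossartPiltant2008_prop44`, F-71): the REGULAR-CURVE slice relative to an open, DERIVED from the isolated
# `τ = 1` point slice and Lemma 4.3 (4) `Γ′` (the patching skeleton's `stub_curve` is no longer an independent input)

[L1 W4.5a · crux `FInjectiveMacaulayfication` (stmt-ResolutionOfSingularities-15315); D-0154 (2) RES inputs cell, seat res-inputs-p-8b (gen 2,
«assembly»). PROVED, fact-free, definition-free; nothing of the manuscript under adjudication is used. AI-written; AI review is weaker than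
expert review.]

THE POINT. The cell's assembly of F-71 by patching slices (`plan/inputs/candidates/F71_ASSEMBLY_W46_SKELETON_p8b.lean` v2, composition
`cossartPiltant2008_prop44_of_stubs` PROVED) had THREE sorried inputs: `stub_reach`, `stub_tauOne_point` (the isolated `τ = 1` threefold point
relative to an open) and `stub_curve` (a regular equimultiple curve through a `τ = 1` point, relative to an open). This file proves
`stub_curve` FROM `stub_tauOne_point` and from [CoP1] Lemma 4.3 (4) "`Γ′` is either empty or a regular irreducible curve projecting isomorphically
to `Y`" (the cell's stub `stub_T2b'_isRegular_gammaPrime`, SIGNATURES v3 l.212) — both entering as HYPOTHESES whose binder lists are those stub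
signatures verbatim (`hpt` with the referee's rider `hcodim`, R29; `hT2b'`), so that the stubs, once landed, instantiate them by `exact`. It is
the curve half of Cossart–Piltant's argument on p. 10, in the W4.6 currency (`CampaignW46.OrderReducible`):

* blow the curve `Y = cl{η}` up; the input invariants persist (`IsPermissibleBlowupSeq.prop44Invariants`, p615828; dimension `≤ 3` by
  `IsBlowup.topologicalKrullDim_le`); a point of the transform of order `≥ m` maps outside `V` or is a NEAR point over `Y`;
* if a point `η′` over the generic point `η` is near ("working above the generic point `η(i)` of some one dimensional component of `Σ(i)`"),
  `Γ′ = cl{η′}` is a regular curve of near points onto `Y` (`hT2b'`), and by the uniqueness of near points over a curve centre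
  (`IsBlowup.eq_of_isNear_of_isNear_curve`, p613580, res-inputs-p-8a) the points of order `≥ m` over `V` are EXACTLY those of `Γ′`; the colength
  `λ(𝒪_{X′,η′}/J′_{η′}) < λ(𝒪_{X,η}/J_η)` drops ([47] App. 5 = tree `IsBlowup.colength_weakTransform_lt`, p611297) — INDUCTION on the colength
  (`orderReducible_comap_of_curve_aux`);
* otherwise the near points over `Y` form a closed (upper semicontinuity of the order on the quasi-excellent `X′`,
  `isClosed_setOf_le_idealOrder_of_isJ2`) set of CLOSED points (`IsBlowup.isClosed_singleton_of_isNear_curve`; the non-generic points of `Y` are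
  closed, `isClosed_singleton_of_mem_closure_of_ne`), hence FINITE (`finite_of_isClosed_of_forall_isClosed_singleton`); each is a threefold point
  (`IsBlowup.isRegularLocalRing_and_spanFinrank_eq_of_isNear_curve`, p616045, res-inputs-p-8a) of order `m` with `τ ≥ 1` and a G-ring local ring,
  isolated off the others inside `π⁻¹V`: settled by `hpt` (`τ = 1`) or by W4.6's PROVED `orderReducible_comap_of_isolated_two_le_tau` (`τ ≥ 2`),
  and the pieces patch over the open `π⁻¹V` (`orderReducible_comap_of_finite_of_forall_nhds` = `OrderReducible.of_finite_of_forall_nhds`,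
  p508549, on the open subscheme); the result over `π⁻¹V` is read back over `V` along the blowing up (`orderReducible_comap_of_seq_of_comap_preimage`,
  étale functoriality p500660).

## What is proved (no definitions, no named facts; plumbing in `…Prop44SliceCurvePlumbing.lean`)
`orderReducible_comap_of_curve_step` (one blowing up of the curve, cases (A)/(B) above), `orderReducible_comap_of_curve_aux` (induction),
`orderReducible_comap_of_curve_of_pointSlice` — THE SLICE (no `τ` hypothesis on `Y`), and `stub_curve_of_pointSlice` — the skeleton's `stub_curve`
binders VERBATIM plus two riders, `[IsNoetherian X]` (for `[IsLocallyNoetherian X]`; free at the call site, where the stage is Noetherian by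
`prop44Invariants_stage`) and `hX3 : topologicalKrullDim X ≤ 3` (referee R29), then the two oracles.

HONEST STATUS. This proves NOTHING of the `τ = 1` engine (`stub_tauOne_point`: CP Lemma 4.5 / CJS Thms. 13.7–14.4, bricks B1/B6/N2 of the W4.6
lineage) nor Lemma 4.3 (4) `Γ′` (T2b′); it removes `stub_curve` as an INDEPENDENT input of the assembly. `CossartPiltant2008_prop44` is NOT proved;
resolution in dimension `≥ 4` / positive characteristic is NOT proved.

References: V. Cossart, O. Piltant, J. Algebra 320 (2008), Lemma 4.3 (2) (4), Prop. 4.4 (proof, p. 10) [CossartPiltant2008]; O. Zariski,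
P. Samuel, *Commutative Algebra* II, App. 5, Thm. 3 [ZariskiSamuel1960]; O. Piltant, RACSAM 107 (2013), Prop. 5.1 [Piltant2013].
-/

-- `Summit.<Summit>.<Sub>.Theorems` with `Sub = Summit` (single-conjunct summit, D-0017)
set_option linter.dupNamespace false

noncomputable section

open CategoryTheory CategoryTheory.Limits AlgebraicGeometry TopologicalSpace IsLocalRing
open Literature.AlgebraicGeometry.Resolution Scheme.IdealSheafData

namespace Summit.ResolutionOfSingularities.ResolutionOfSingularities.Theorems

namespace CP2008Prop44

universe u

/-! ## §2 The step: one blowing up of the curve -/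

/-- **THE STEP of the induction.** In the situation of `orderReducible_comap_of_curve_of_pointSlice` (curve `Y = cl{η}`, `codim η = 2`),
suppose the conclusion is known for every such datum — on any integral Noetherian regular quasi-excellent `X′` of dimension `≤ 3`, same `m` — whose
colength `λ(𝒪_{X′,η′}/J′_{η′})` at the generic point is SMALLER than `λ(𝒪_{X,η}/J_η)` (hypothesis `ih`). Then `(V, J|_V, m)` is
order-reducible. Blow `Y` up (`π : X′ → X`, `J′` the weak transform; the invariants persist, p615828). Points of `X′` of order `≥ m` map outside
`V` or are NEAR points over `Y`. (B) If some `η′` over `η` is near: `Γ′ = cl{η′}` is a regular curve, all of whose points are near, mapping onto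
`Y` (oracle `hT2b'`, Lemma 4.3 (4)); by uniqueness of near points over a curve centre (p613580) the points of order `≥ m` over `V` are EXACTLY
those of `Γ′`; `codim η′ = 2`; the colength dropped (Zariski–Samuel App. 5 / Huneke–Swanson 14.3.4, tree `colength_weakTransform_lt`) — apply
`ih` on `X′` and read the result over `V` (`orderReducible_comap_of_seq_of_comap_preimage`). (A) Otherwise the near points form a closed
(upper semicontinuity of the order on the quasi-excellent `X′`) set of CLOSED points (`isClosed_singleton_of_isNear_curve`) inside `π⁻¹V`,
hence FINITE; each is a threefold point (p616045) of order `m`, with `τ ≥ 1` and a G-ring, isolated in `π⁻¹V` off the others — settled by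
the oracle `hpt` (`τ = 1`) or W4.6's `orderReducible_comap_of_isolated_two_le_tau` (`τ ≥ 2`) — and these pieces patch over `π⁻¹V`
(`orderReducible_comap_of_finite_of_forall_nhds`). [cite: CossartPiltant2008, Prop. 4.4 (proof, p. 10), Lemma 4.3 (2) (4)]
[cite: Piltant2013, Prop. 5.1 (proof, Step 2)] -/
theorem orderReducible_comap_of_curve_step
    (hpt : ∀ ⦃X : Scheme.{u}⦄ [IsLocallyNoetherian X] (hX : Scheme.IsRegular X) (J : X.IdealSheafData) ⦃m : ℕ⦄ (_hm : 1 ≤ m)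
      (_hle : ∀ z, idealOrder J z ≤ m) (_hcodim : ∀ z ∈ J.support, 1 < Order.coheight z) (V : X.Opens) (x : X) (_hxV : x ∈ V)
      (_hcl : IsClosed ({x} : Set X)) (_hbad : ∀ z : X, (m : ℕ∞) ≤ idealOrder J z → z = x ∨ z ∉ (V : Set X))
      (_hord : idealOrder J x = m) (_hdim : (maximalIdeal (X.presheaf.stalk x)).spanFinrank = 3)
      (_hτ : haveI := hX x; stalkTau J x m = 1) (_hG : IsGRing (X.presheaf.stalk x)),
      CampaignW46.OrderReducible (J.comap V.ι) m)
    (hT2b' : ∀ ⦃X' X : Scheme.{u}⦄ [IsLocallyNoetherian X] [IsLocallyNoetherian X'] (_hX : Scheme.IsRegular X) ⦃π : X' ⟶ X⦄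
      ⦃Y : Closeds X⦄ (_hYirr : IsIrreducible ((Y : Closeds X) : Set X))
      (_hreg : Scheme.IsRegular (vanishingIdeal Y).subscheme) (_hπ : IsBlowup π (vanishingIdeal Y))
      ⦃J : X.IdealSheafData⦄ ⦃μ : ℕ⦄ (_hμ : 1 ≤ μ) (_hY : ∀ y ∈ (Y : Set X), idealOrder J y = μ)
      (_hJ : ∀ x, idealOrder J x ≤ μ) ⦃η' : X'⦄ (_hη' : closure {π η'} = (Y : Set X))
      (_hcodim : Order.coheight (π η') = 2) (_hnear : IsNear π (vanishingIdeal Y) J μ η'),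
      Scheme.IsRegular (vanishingIdeal (⟨closure {η'}, isClosed_closure⟩ : Closeds X')).subscheme ∧
        (∀ z ∈ closure ({η'} : Set X'), IsNear π (vanishingIdeal Y) J μ z) ∧
        π '' closure ({η'} : Set X') = (Y : Set X))
    {m : ℕ} (hm : 1 ≤ m)
    {X : Scheme.{u}} [IsIntegral X] [IsNoetherian X] (hX : Scheme.IsRegular X) (hqe : Scheme.IsQuasiExcellent X)
    (hX3 : topologicalKrullDim X ≤ 3) (J : X.IdealSheafData) (hle : ∀ z, idealOrder J z ≤ m)
    (hcodim : ∀ z ∈ J.support, 1 < Order.coheight z) (V : X.Opens) (Y : Closeds X) (η : X) (hYη : (Y : Set X) = closure {η})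
    (hcoh : Order.coheight η = 2) (hreg : Scheme.IsRegular (vanishingIdeal Y).subscheme) (hYV : (Y : Set X) ⊆ (V : Set X))
    (hJY : ∀ z : X, (m : ℕ∞) ≤ idealOrder J z → z ∈ (Y : Set X) ∨ z ∉ (V : Set X))
    (hord : ∀ y ∈ (Y : Set X), idealOrder J y = m)
    (ih : ∀ ⦃X' : Scheme.{u}⦄ [IsIntegral X'] [IsNoetherian X'], Scheme.IsRegular X' → Scheme.IsQuasiExcellent X' →
      topologicalKrullDim X' ≤ 3 → ∀ (J' : X'.IdealSheafData), (∀ z, idealOrder J' z ≤ m) →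
      (∀ z ∈ J'.support, 1 < Order.coheight z) → ∀ (V' : X'.Opens) (Y' : Closeds X') (η' : X'),
      (Y' : Set X') = closure {η'} → Order.coheight η' = 2 → Scheme.IsRegular (vanishingIdeal Y').subscheme →
      (Y' : Set X') ⊆ (V' : Set X') → (∀ z : X', (m : ℕ∞) ≤ idealOrder J' z → z ∈ (Y' : Set X') ∨ z ∉ (V' : Set X')) →
      (∀ y ∈ (Y' : Set X'), idealOrder J' y = m) →
      Module.length (X'.presheaf.stalk η') (X'.presheaf.stalk η' ⧸ stalkIdeal J' η') <
        Module.length (X.presheaf.stalk η) (X.presheaf.stalk η ⧸ stalkIdeal J η) →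
      CampaignW46.OrderReducible (J'.comap V'.ι) m) :
    CampaignW46.OrderReducible (J.comap V.ι) m := by
  classical
  have hcoh3 : ∀ z : X, Order.coheight z ≤ 3 := (topologicalKrullDim_le_iff_forall_coheight_le X 3).mp hX3
  have hηY : η ∈ (Y : Set X) := by rw [hYη]; exact subset_closure rfl
  have hD : ∀ y ∈ (Y : Set X), (m : ℕ∞) ≤ idealOrder J y := fun y hy => (hord y hy).ge
  have hpair : ∀ y ∈ (Y : Set X), haveI := hX y; ∃ c : Fin 2 → X.presheaf.stalk y, IsRsopPart c ∧
      Ideal.span (Set.range c) = stalkIdeal (vanishingIdeal Y) y := fun y hy =>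
    exists_rsopPair_of_mem_curve hX hcoh3 hreg hYη hcoh hy
  -- the blowing up of `Y`
  obtain ⟨X', π, hπ⟩ := exists_isBlowup X (vanishingIdeal Y)
  have hseq1 : CampaignW46.IsPermissibleBlowupSeq J m π (controlledTransform π (vanishingIdeal Y) J m) :=
    CampaignW46.IsPermissibleBlowupSeq.single Y π hreg hD hπ
  obtain ⟨hint', hnoeth', hX', hqe', hle', hcodim'⟩ := IsPermissibleBlowupSeq.prop44Invariants hX hqe hm hle hcodim hseq1
  haveI := hint'
  haveI := hnoeth'
  have hX3' : topologicalKrullDim X' ≤ 3 := hπ.topologicalKrullDim_le hX3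
  have hcoh3' : ∀ z : X', Order.coheight z ≤ 3 := (topologicalKrullDim_le_iff_forall_coheight_le X' 3).mp hX3'
  set J' := controlledTransform π (vanishingIdeal Y) J m with hJ'def
  -- the points of `X'` of order `≥ m`: near points over `Y`, or over the complement of `V`
  have hbad' : ∀ z : X', (m : ℕ∞) ≤ idealOrder J' z →
      (π z ∈ (Y : Set X) ∧ IsNear π (vanishingIdeal Y) J m z) ∨ π z ∉ (V : Set X) := by
    intro z hz
    by_cases hmem : π z ∈ (Y : Set X)
    · exact Or.inl ⟨hmem, isNear_iff.mpr (le_antisymm (hπ.idealOrder_controlledTransform_le_of_mem hX hreg hord hmem) hz)⟩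
    · right
      have hmem' : π z ∉ ((vanishingIdeal Y).support : Set X) := by rwa [Scheme.IdealSheafData.coe_support_vanishingIdeal]
      rw [hJ'def, hπ.idealOrder_controlledTransform_of_not_mem J m hmem'] at hz
      rcases hJY _ hz with h | h
      · exact absurd h hmem
      · exact h
  by_cases hB : ∃ η' : X', π η' = η ∧ IsNear π (vanishingIdeal Y) J m η'
  · /- CASE (B): a near point over the generic point — the new curve `Γ′`, smaller colength -/
    obtain ⟨η', hη'η, hnearη'⟩ := hB
    have hirrY : IsIrreducible (Y : Set X) := by rw [hYη]; exact isIrreducible_singleton.closure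
    have hclη' : closure {π η'} = (Y : Set X) := by rw [hη'η, hYη]
    have hcohπη' : Order.coheight (π η') = 2 := by rw [hη'η]; exact hcoh
    obtain ⟨hregΓ, hnearΓ, hontoΓ⟩ := hT2b' hX hirrY hreg hπ hm hord hle hclη' hcohπη' hnearη'
    set Γ : Closeds X' := ⟨closure {η'}, isClosed_closure⟩ with hΓdef
    have hΓη : ((Γ : Closeds X') : Set X') = closure {η'} := rfl
    -- `codim η' = 2`
    have hcohη' : Order.coheight η' = 2 := by
      apply le_antisymm
      · have h := hπ.coheight_le η'
        rwa [hcohπη'] at h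
      · have hsupp : η' ∈ J'.support := by
          rw [← one_le_idealOrder_iff, hJ'def, isNear_iff.mp hnearη']
          exact_mod_cast hm
        have h1 : (1 : ℕ∞) < Order.coheight η' := hcodim' η' hsupp
        exact Order.add_one_le_of_lt h1
    -- `ord = m` along `Γ′`, `Γ′` over `V`
    have hordΓ : ∀ z ∈ ((Γ : Closeds X') : Set X'), idealOrder J' z = m := fun z hz => isNear_iff.mp (hnearΓ z hz)
    have hΓV : ((Γ : Closeds X') : Set X') ⊆ ((π ⁻¹ᵁ V : X'.Opens) : Set X') := by
      intro z hz
      show π z ∈ (V : Set X)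
      exact hYV (hontoΓ ▸ Set.mem_image_of_mem π hz)
    -- the bad points over `V` are exactly the points of `Γ′`
    have hbadΓ : ∀ z : X', (m : ℕ∞) ≤ idealOrder J' z →
        z ∈ ((Γ : Closeds X') : Set X') ∨ z ∉ ((π ⁻¹ᵁ V : X'.Opens) : Set X') := by
      intro z hz
      rcases hbad' z hz with ⟨hzY, hzn⟩ | h
      · left
        obtain ⟨γ, hγ, hπγ⟩ : ∃ γ ∈ closure ({η'} : Set X'), π γ = π z := by
          have : π z ∈ π '' closure ({η'} : Set X') := by rw [hontoΓ]; exact hzY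
          exact this
        haveI := hX (π z)
        obtain ⟨c, hcr, hcY⟩ := hpair (π z) hzY
        have hγz : γ = z := hπ.eq_of_isNear_of_isNear_curve hX hreg hm hord hcr hcY hzn (hnearΓ γ hγ) hπγ
        rw [← hγz]
        exact hγ
      · exact Or.inr h
    -- the colength dropped
    haveI := hX η
    have hmax : η ∈ maxPoints (J.support : Set X) :=
      mem_maxPoints_support_of_coheight_eq_two hcodim
        (by rw [SetLike.mem_coe, ← one_le_idealOrder_iff, hord η hηY]; exact_mod_cast hm) hcoh
    have hlt : Module.length (X'.presheaf.stalk η') (X'.presheaf.stalk η' ⧸ stalkIdeal J' η') <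
        Module.length (X.presheaf.stalk η) (X.presheaf.stalk η ⧸ stalkIdeal J η) :=
      hπ.colength_weakTransform_lt hm hord hη'η (isNear_iff.mp hnearη') (hX η) (spanFinrank_maximalIdeal_stalk_eq η hcoh)
        (stalkIdeal_vanishingIdeal_eq_maximalIdeal_of_closure_eq hYη) (isFiniteLength_quotient_stalkIdeal_of_mem_maxPoints hmax)
    have hred : CampaignW46.OrderReducible (J'.comap (π ⁻¹ᵁ V).ι) m :=
      ih hX' hqe' hX3' J' hle' hcodim' (π ⁻¹ᵁ V) Γ η' hΓη hcohη' hregΓ hΓV hbadΓ hordΓ hlt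
    exact orderReducible_comap_of_seq_of_comap_preimage hseq1 V hred
  · /- CASE (A): no near point over the generic point — finitely many near closed points, patched -/
    push Not at hB
    -- the near locus over `Y`
    set N : Set X' := {z : X' | π z ∈ (Y : Set X) ∧ (m : ℕ∞) ≤ idealOrder J' z} with hNdef
    have hN_near : ∀ z ∈ N, IsNear π (vanishingIdeal Y) J m z := fun z hz =>
      isNear_iff.mpr (le_antisymm (hπ.idealOrder_controlledTransform_le_of_mem hX hreg hord hz.1) hz.2)
    have hN_ne : ∀ z ∈ N, π z ≠ η := fun z hz h => hB z h (hN_near z hz)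
    have hN_base : ∀ z ∈ N, Order.coheight (π z) = 3 ∧ IsClosed ({π z} : Set X) := fun z hz =>
      isClosed_singleton_of_mem_closure_of_ne hcoh3 hcoh (hYη ▸ hz.1) (hN_ne z hz)
    have hN_closedPt : ∀ z ∈ N, IsClosed ({z} : Set X') := by
      intro z hz
      haveI := hX (π z)
      obtain ⟨c, hcr, hcY⟩ := hpair (π z) hz.1
      exact hπ.isClosed_singleton_of_isNear_curve hX hX' hreg hm hord (hN_base z hz).2 hcr hcY (hN_near z hz)
    have hN_dim : ∀ z ∈ N, (maximalIdeal (X'.presheaf.stalk z)).spanFinrank = 3 := by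
      intro z hz
      haveI := hX (π z)
      obtain ⟨c, hcr, hcY⟩ := hpair (π z) hz.1
      rw [(hπ.isRegularLocalRing_and_spanFinrank_eq_of_isNear_curve hX hreg hm hord hcr hcY (hN_near z hz)).2]
      exact spanFinrank_maximalIdeal_stalk_eq (π z) (hN_base z hz).1
    have hN_ord : ∀ z ∈ N, idealOrder J' z = m := fun z hz => isNear_iff.mp (hN_near z hz)
    -- `N` is closed (upper semicontinuity of the order on the quasi-excellent `X'`) and consists of closed points: FINITE
    have hJ'ne : J' ≠ ⊥ := ne_bot_of_forall_one_lt_coheight hcodim'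
    have hOrdCl : IsClosed {z : X' | (m : ℕ∞) ≤ idealOrder J' z} :=
      isClosed_setOf_le_idealOrder_of_isJ2 hX' (fun U => (hqe' U).isJ2Ring) hJ'ne m
    have hNcl : IsClosed N := (Y.isClosed.preimage π.continuous).inter hOrdCl
    have hNfin : N.Finite := finite_of_isClosed_of_forall_isClosed_singleton hNcl hN_closedPt
    -- every bad point over `V` lies in `N`
    have hNV : ∀ z : X', z ∈ ((π ⁻¹ᵁ V : X'.Opens) : Set X') → (m : ℕ∞) ≤ idealOrder J' z → z ∈ N := by
      intro z hzV hz
      rcases hbad' z hz with ⟨hzY, -⟩ | h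
      · exact ⟨hzY, hz⟩
      · exact absurd hzV h
    -- patch the point slices over `π⁻¹ V`
    have hred : CampaignW46.OrderReducible (J'.comap (π ⁻¹ᵁ V).ι) m := by
      refine orderReducible_comap_of_finite_of_forall_nhds hX' J' (π ⁻¹ᵁ V) N hNfin hN_closedPt hNV fun x hx => ?_
      have hcl : IsClosed (N \ {x}) := isClosed_diff_singleton_of_finite hNfin hN_closedPt x
      let W : X'.Opens := ⟨((π ⁻¹ᵁ V : X'.Opens) : Set X') \ (N \ {x}), (π ⁻¹ᵁ V).2.sdiff hcl⟩
      have hxW : x ∈ W := ⟨show π x ∈ (V : Set X) from hYV hx.1, fun h => h.2 rfl⟩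
      have hWV : W ≤ π ⁻¹ᵁ V := fun z hz => hz.1
      have hbadW : ∀ z : X', (m : ℕ∞) ≤ idealOrder J' z → z = x ∨ z ∉ (W : Set X') := by
        intro z hz
        by_cases hzW : z ∈ (W : Set X')
        · left
          have hzN : z ∈ N := hNV z hzW.1 hz
          by_contra hne
          exact hzW.2 ⟨hzN, hne⟩
        · exact Or.inr hzW
      haveI : IsRegularLocalRing (X'.presheaf.stalk x) := hX' x
      have hG : IsGRing (X'.presheaf.stalk x) := Scheme.isGRing_stalk_of_isQuasiExcellent hqe' x
      refine ⟨W, hxW, hWV, ?_⟩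
      by_cases hτ : stalkTau J' x m = 1
      · exact hpt hX' J' hm hle' hcodim' W x hxW (hN_closedPt x hx) hbadW (hN_ord x hx) (hN_dim x hx) hτ hG
      · have hτ2 : 2 ≤ stalkTau J' x m := by
          have h1 : 1 ≤ stalkTau J' x m := (hN_near x hx).one_le_stalkTau hm
          omega
        exact CampaignW46.orderReducible_comap_of_isolated_two_le_tau hX' J' hm W x hxW (hN_closedPt x hx) hbadW (hN_ord x hx)
          (hN_dim x hx) hτ2 hG
    exact orderReducible_comap_of_seq_of_comap_preimage hseq1 V hred


/-! ## §3 The induction on the colength, and the slice -/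

/-- **The induction on a bound `N` for the colength `λ(𝒪_{X,η}/J_η)` at the generic point of the curve** ([CoP1] p. 10: "working above
the generic point `η(i)` … `J𝒪_{X(i),η(i)}` principal for `i ≫ 0` … hence `n(i)` eventually drops").
[cite: CossartPiltant2008, Prop. 4.4 (proof, p. 10)] [cite: ZariskiSamuel1960, Appendix 5, Thm. 3] -/
theorem orderReducible_comap_of_curve_aux
    (hpt : ∀ ⦃X : Scheme.{u}⦄ [IsLocallyNoetherian X] (hX : Scheme.IsRegular X) (J : X.IdealSheafData) ⦃m : ℕ⦄ (_hm : 1 ≤ m)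
      (_hle : ∀ z, idealOrder J z ≤ m) (_hcodim : ∀ z ∈ J.support, 1 < Order.coheight z) (V : X.Opens) (x : X) (_hxV : x ∈ V)
      (_hcl : IsClosed ({x} : Set X)) (_hbad : ∀ z : X, (m : ℕ∞) ≤ idealOrder J z → z = x ∨ z ∉ (V : Set X))
      (_hord : idealOrder J x = m) (_hdim : (maximalIdeal (X.presheaf.stalk x)).spanFinrank = 3)
      (_hτ : haveI := hX x; stalkTau J x m = 1) (_hG : IsGRing (X.presheaf.stalk x)),
      CampaignW46.OrderReducible (J.comap V.ι) m)
    (hT2b' : ∀ ⦃X' X : Scheme.{u}⦄ [IsLocallyNoetherian X] [IsLocallyNoetherian X'] (_hX : Scheme.IsRegular X) ⦃π : X' ⟶ X⦄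
      ⦃Y : Closeds X⦄ (_hYirr : IsIrreducible ((Y : Closeds X) : Set X))
      (_hreg : Scheme.IsRegular (vanishingIdeal Y).subscheme) (_hπ : IsBlowup π (vanishingIdeal Y))
      ⦃J : X.IdealSheafData⦄ ⦃μ : ℕ⦄ (_hμ : 1 ≤ μ) (_hY : ∀ y ∈ (Y : Set X), idealOrder J y = μ)
      (_hJ : ∀ x, idealOrder J x ≤ μ) ⦃η' : X'⦄ (_hη' : closure {π η'} = (Y : Set X))
      (_hcodim : Order.coheight (π η') = 2) (_hnear : IsNear π (vanishingIdeal Y) J μ η'),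
      Scheme.IsRegular (vanishingIdeal (⟨closure {η'}, isClosed_closure⟩ : Closeds X')).subscheme ∧
        (∀ z ∈ closure ({η'} : Set X'), IsNear π (vanishingIdeal Y) J μ z) ∧
        π '' closure ({η'} : Set X') = (Y : Set X))
    {m : ℕ} (hm : 1 ≤ m) (N : ℕ) :
    ∀ ⦃X : Scheme.{u}⦄ [IsIntegral X] [IsNoetherian X], Scheme.IsRegular X → Scheme.IsQuasiExcellent X →
      topologicalKrullDim X ≤ 3 → ∀ (J : X.IdealSheafData), (∀ z, idealOrder J z ≤ m) →
      (∀ z ∈ J.support, 1 < Order.coheight z) → ∀ (V : X.Opens) (Y : Closeds X) (η : X),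
      (Y : Set X) = closure {η} → Order.coheight η = 2 → Scheme.IsRegular (vanishingIdeal Y).subscheme →
      (Y : Set X) ⊆ (V : Set X) → (∀ z : X, (m : ℕ∞) ≤ idealOrder J z → z ∈ (Y : Set X) ∨ z ∉ (V : Set X)) →
      (∀ y ∈ (Y : Set X), idealOrder J y = m) →
      Module.length (X.presheaf.stalk η) (X.presheaf.stalk η ⧸ stalkIdeal J η) ≤ N →
      CampaignW46.OrderReducible (J.comap V.ι) m := by
  induction N with
  | zero =>
    intro X _ _ hX hqe hX3 J hle hcodim V Y η hYη hcoh hreg hYV hJY hord hlen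
    exact orderReducible_comap_of_curve_step hpt hT2b' hm hX hqe hX3 J hle hcodim V Y η hYη hcoh hreg hYV hJY hord
      fun X' _ _ _ _ _ J' _ _ V' Y' η' _ _ _ _ _ _ hlt => by
        exfalso
        have h := hlt.trans_le hlen
        simp at h
  | succ N ih =>
    intro X _ _ hX hqe hX3 J hle hcodim V Y η hYη hcoh hreg hYV hJY hord hlen
    exact orderReducible_comap_of_curve_step hpt hT2b' hm hX hqe hX3 J hle hcodim V Y η hYη hcoh hreg hYV hJY hord
      fun X' _ _ hX' hqe' hX3' J' hle' hcodim' V' Y' η' hYη' hcoh' hreg' hYV' hJY' hord' hlt =>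
        ih hX' hqe' hX3' J' hle' hcodim' V' Y' η' hYη' hcoh' hreg' hYV' hJY' hord'
          (enat_le_of_lt_of_le_add_one hlt (by exact_mod_cast hlen))

/-- **THE REGULAR-CURVE SLICE OF [CoP1] PROP. 4.4 RELATIVE TO AN OPEN, FROM THE ISOLATED `τ = 1` POINT SLICE AND LEMMA 4.3 (4) `Γ′`.**
`X` integral NOETHERIAN regular quasi-excellent of dimension `≤ 3`; `J`, `m ≥ 1`, `ord ≤ m` everywhere, `V(J)` of codimension `≥ 2`; `V ⊆ X`
open; `Y ⊆ V` closed irreducible with `V(𝓘_Y)` regular, `ord = m` on `Y`, `𝓘_{Y,y}` generated by a pair of regular parameters at every `y ∈ Y`;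
every point of order `≥ m` on `Y` or outside `V`. HYPOTHESES-AS-ORACLES (their binder lists are the cell's stub signatures verbatim, so that the
landed stubs instantiate them by `exact`): `hpt` = the isolated `τ = 1` threefold-point slice relative to an open (`stub_tauOne_point` of the
patching skeleton, with the referee's rider `hcodim`); `hT2b'` = Lemma 4.3 (4) "`Γ′` is either empty or a regular irreducible curve projecting
isomorphically to `Y`" (`stub_T2b'_isRegular_gammaPrime`). CONCLUSION: `(V, J|_V, m)` is order-reducible by permissible blowing-ups. No `τ`
hypothesis on `Y` (a curve with `τ ≥ 2` everywhere has no near points at all). The proof is the curve part of Cossart–Piltant's: blow the curve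
up as long as its generic point stays near (finitely often: colength, `orderReducible_comap_of_curve_aux`), then settle the finitely many near
closed points by the point slices and patch. [cite: CossartPiltant2008, Prop. 4.4 (proof, p. 10), Lemma 4.3 (2) (4)]
[cite: Piltant2013, Prop. 5.1 (proof, Step 2)] -/
theorem orderReducible_comap_of_curve_of_pointSlice {X : Scheme.{u}} [IsIntegral X] [IsNoetherian X]
    (hX : Scheme.IsRegular X) (hqe : Scheme.IsQuasiExcellent X) (hX3 : topologicalKrullDim X ≤ 3)
    (J : X.IdealSheafData) {m : ℕ} (hm : 1 ≤ m) (hle : ∀ z, idealOrder J z ≤ m)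
    (hcodim : ∀ z ∈ J.support, 1 < Order.coheight z) (V : X.Opens) (Y : Closeds X)
    (hreg : Scheme.IsRegular (vanishingIdeal Y).subscheme) (hirr : IsIrreducible (Y : Set X))
    (hYV : (Y : Set X) ⊆ (V : Set X))
    (hJY : ∀ z : X, (m : ℕ∞) ≤ idealOrder J z → z ∈ (Y : Set X) ∨ z ∉ (V : Set X))
    (hord : ∀ y ∈ (Y : Set X), idealOrder J y = m)
    (hcurve : ∀ y ∈ (Y : Set X), haveI := hX y; ∃ c : Fin 2 → X.presheaf.stalk y, IsRsopPart c ∧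
      Ideal.span (Set.range c) = stalkIdeal (vanishingIdeal Y) y)
    (hpt : ∀ ⦃X : Scheme.{u}⦄ [IsLocallyNoetherian X] (hX : Scheme.IsRegular X) (J : X.IdealSheafData) ⦃m : ℕ⦄ (_hm : 1 ≤ m)
      (_hle : ∀ z, idealOrder J z ≤ m) (_hcodim : ∀ z ∈ J.support, 1 < Order.coheight z) (V : X.Opens) (x : X) (_hxV : x ∈ V)
      (_hcl : IsClosed ({x} : Set X)) (_hbad : ∀ z : X, (m : ℕ∞) ≤ idealOrder J z → z = x ∨ z ∉ (V : Set X))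
      (_hord : idealOrder J x = m) (_hdim : (maximalIdeal (X.presheaf.stalk x)).spanFinrank = 3)
      (_hτ : haveI := hX x; stalkTau J x m = 1) (_hG : IsGRing (X.presheaf.stalk x)),
      CampaignW46.OrderReducible (J.comap V.ι) m)
    (hT2b' : ∀ ⦃X' X : Scheme.{u}⦄ [IsLocallyNoetherian X] [IsLocallyNoetherian X'] (_hX : Scheme.IsRegular X) ⦃π : X' ⟶ X⦄
      ⦃Y : Closeds X⦄ (_hYirr : IsIrreducible ((Y : Closeds X) : Set X))
      (_hreg : Scheme.IsRegular (vanishingIdeal Y).subscheme) (_hπ : IsBlowup π (vanishingIdeal Y))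
      ⦃J : X.IdealSheafData⦄ ⦃μ : ℕ⦄ (_hμ : 1 ≤ μ) (_hY : ∀ y ∈ (Y : Set X), idealOrder J y = μ)
      (_hJ : ∀ x, idealOrder J x ≤ μ) ⦃η' : X'⦄ (_hη' : closure {π η'} = (Y : Set X))
      (_hcodim : Order.coheight (π η') = 2) (_hnear : IsNear π (vanishingIdeal Y) J μ η'),
      Scheme.IsRegular (vanishingIdeal (⟨closure {η'}, isClosed_closure⟩ : Closeds X')).subscheme ∧
        (∀ z ∈ closure ({η'} : Set X'), IsNear π (vanishingIdeal Y) J μ z) ∧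
        π '' closure ({η'} : Set X') = (Y : Set X)) :
    CampaignW46.OrderReducible (J.comap V.ι) m := by
  -- the generic point `η` of `Y`, of codimension `2`
  let η : X := hirr.genericPoint
  have hYη : (Y : Set X) = closure {η} := (hirr.closure_genericPoint Y.isClosed).symm
  have hηY : η ∈ (Y : Set X) := by rw [hYη]; exact subset_closure rfl
  haveI := hX η
  have hcoh : Order.coheight η = 2 := by
    obtain ⟨c, hcr, hcY⟩ := hcurve η hηY
    rw [stalkIdeal_vanishingIdeal_eq_maximalIdeal_of_closure_eq hYη] at hcY
    have hq := hcr.ringKrullDim_quotient_add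
    rw [hcY] at hq
    letI := Ideal.Quotient.field (maximalIdeal (X.presheaf.stalk η))
    rw [ringKrullDim_eq_zero_of_field, zero_add, ringKrullDim_stalk_eq_coheight] at hq
    have h2 : ((Order.coheight η : ℕ∞) : WithBot ℕ∞) = ((2 : ℕ∞) : WithBot ℕ∞) := hq.symm.trans (by rfl)
    exact WithBot.coe_injective h2
  -- the colength at `η` is finite
  have hmax : η ∈ maxPoints (J.support : Set X) :=
    mem_maxPoints_support_of_coheight_eq_two hcodim
      (by rw [SetLike.mem_coe, ← one_le_idealOrder_iff, hord η hηY]; exact_mod_cast hm) hcoh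
  obtain ⟨N, hN⟩ := ENat.ne_top_iff_exists.mp (length_quotient_stalkIdeal_ne_top_of_mem_maxPoints hmax)
  exact orderReducible_comap_of_curve_aux hpt hT2b' hm N hX hqe hX3 J hle hcodim V Y η hYη hcoh hreg hYV hJY hord hN.symm.le

/-- **The patching skeleton's `stub_curve`, DERIVED** — binders of `stub_curve` (`candidates/F71_ASSEMBLY_W46_SKELETON_p8b.lean` v2, l.71)
VERBATIM, with the two riders `[IsNoetherian X]` (in place of `[IsLocallyNoetherian X]`; free at the call site) and `hX3` (referee R29), followed
by the two oracles; `hτ1` is not used. [cite: CossartPiltant2008, Prop. 4.4 (proof, p. 10), Lemma 4.3 (2) (4), Lemma 4.5 (1)] -/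
theorem stub_curve_of_pointSlice {X : Scheme.{u}} [IsIntegral X] [IsNoetherian X] (hX : Scheme.IsRegular X)
    (hqe : Scheme.IsQuasiExcellent X) (hX3 : topologicalKrullDim X ≤ 3) (J : X.IdealSheafData) {m : ℕ} (hm : 1 ≤ m)
    (hle : ∀ z, idealOrder J z ≤ m)
    (hcodim : ∀ z ∈ J.support, 1 < Order.coheight z) (V : X.Opens) (Y : Closeds X)
    (hreg : Scheme.IsRegular (vanishingIdeal Y).subscheme) (hirr : IsIrreducible (Y : Set X)) (hYV : (Y : Set X) ⊆ (V : Set X))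
    (hJY : ∀ z : X, (m : ℕ∞) ≤ idealOrder J z → z ∈ (Y : Set X) ∨ z ∉ (V : Set X))
    (hord : ∀ y ∈ (Y : Set X), idealOrder J y = m)
    (hcurve : ∀ y ∈ (Y : Set X), haveI := hX y; ∃ c : Fin 2 → X.presheaf.stalk y, IsRsopPart c ∧
      Ideal.span (Set.range c) = stalkIdeal (vanishingIdeal Y) y)
    (_hτ1 : ¬ ∀ y ∈ (Y : Set X), haveI := hX y; 2 ≤ stalkTau J y m)
    (hpt : ∀ ⦃X : Scheme.{u}⦄ [IsLocallyNoetherian X] (hX : Scheme.IsRegular X) (J : X.IdealSheafData) ⦃m : ℕ⦄ (_hm : 1 ≤ m)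
      (_hle : ∀ z, idealOrder J z ≤ m) (_hcodim : ∀ z ∈ J.support, 1 < Order.coheight z) (V : X.Opens) (x : X) (_hxV : x ∈ V)
      (_hcl : IsClosed ({x} : Set X)) (_hbad : ∀ z : X, (m : ℕ∞) ≤ idealOrder J z → z = x ∨ z ∉ (V : Set X))
      (_hord : idealOrder J x = m) (_hdim : (maximalIdeal (X.presheaf.stalk x)).spanFinrank = 3)
      (_hτ : haveI := hX x; stalkTau J x m = 1) (_hG : IsGRing (X.presheaf.stalk x)),
      CampaignW46.OrderReducible (J.comap V.ι) m)
    (hT2b' : ∀ ⦃X' X : Scheme.{u}⦄ [IsLocallyNoetherian X] [IsLocallyNoetherian X'] (_hX : Scheme.IsRegular X) ⦃π : X' ⟶ X⦄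
      ⦃Y : Closeds X⦄ (_hYirr : IsIrreducible ((Y : Closeds X) : Set X))
      (_hreg : Scheme.IsRegular (vanishingIdeal Y).subscheme) (_hπ : IsBlowup π (vanishingIdeal Y))
      ⦃J : X.IdealSheafData⦄ ⦃μ : ℕ⦄ (_hμ : 1 ≤ μ) (_hY : ∀ y ∈ (Y : Set X), idealOrder J y = μ)
      (_hJ : ∀ x, idealOrder J x ≤ μ) ⦃η' : X'⦄ (_hη' : closure {π η'} = (Y : Set X))
      (_hcodim : Order.coheight (π η') = 2) (_hnear : IsNear π (vanishingIdeal Y) J μ η'),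
      Scheme.IsRegular (vanishingIdeal (⟨closure {η'}, isClosed_closure⟩ : Closeds X')).subscheme ∧
        (∀ z ∈ closure ({η'} : Set X'), IsNear π (vanishingIdeal Y) J μ z) ∧
        π '' closure ({η'} : Set X') = (Y : Set X)) :
    CampaignW46.OrderReducible (J.comap V.ι) m :=
  orderReducible_comap_of_curve_of_pointSlice hX hqe hX3 J hm hle hcodim V Y hreg hirr hYV hJY hord hcurve hpt hT2b'

end CP2008Prop44

end Summit.ResolutionOfSingularities.ResolutionOfSingularities.Theorems

end
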